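import Summits.QuantumFields.YangMills.Theorems.BalabanUVNodesN19TargetAtRecord11
import Summits.QuantumFields.YangMills.Theorems.BalabanUVNodesN27AtRecordReadings
import Summits.QuantumFields.YangMills.Theorems.BalabanUVNodesN27AtRecordK4
import Summits.QuantumFields.YangMills.Theses.BalabanUVNodes
import Literature.MathematicalPhysics.QuantumFieldTheory.Balaban1983to89.T4MatchingDegenerate

/-!
# YM-DAG node N19 (= NE7 proper) AT THE STAGE-11 RECORD, II — N19's DECL TARGET IN THE TREE's OWN NAME `T4ApexVariance.MatchingUnder`, the
# READING «binder B5 at a ₁₁ record IS N19's target along the record's Wilson schemes» (`T4MatchingDegenerate` at `Node00.IsRecordOfRecord₁₁C`),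
# the route item K3 `SpineGivenEndpointR11` READ IN N19's CURRENCY, and the ∃δ-edge supplied from the SYNCHRONISED-LEDGER READING

Cell `pub-ymgap`, HUMAN RULING D-0062 (Track A), R134 acceleration seat `pub-ymgap-dag-n19-d` (strategy s2), module 2 (module 1 =
`BalabanUVNodesN19TargetAtRecord11` p450178 ✓ aee4acc7c57a).  Route `Summits/QuantumFields/YangMills/Theses/BalabanUVNodes.lean` rev 6; filed
`--supports stmt-QuantumFields-19676` (K3 «SpineGivenEndpointR11»).  COUNT-NEUTRAL bookkeeping; NOT a discharge claim; 0 `def`, 0 `sorry`.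

WHAT THIS MODULE RECORDS (tree names).
* §1 THE NAME.  Module 1's conclusion `D.UnderHypotheses END (g₀ ↦ T4ApexVariance.StringwiseMatching (D.scheme g₀))` IS, by `rfl`, the apex lineage's
  `T4ApexVariance.MatchingUnder D END` (T4ApexVariance.lean :1761: «NODE U5's PER-STRING OUTPUT UNDER THE PREFIX») — N19's DECL target
  `T4CauchySum.MatchingModConstants vol l₀ δ Z ∧ Summable δ` (NODE-TABLE row n19) for every loop string along every tuned Wilson scheme of the datum.
  Module 1's top theorems are re-stated in that name (`matchingUnder_at_record₁₁_of_spineRates`, `matchingUnder_at_record₁₁_of_rateStubs`).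
* §2 THE READING AT ₁₁ (n23-b's `T4MatchingDegenerate`, p-lineage of `T4ApexVariance`, BY NAME).  For data with measurable averaging maps binder B5
  `T4ApexHybrid.HybridNE7Under D Hβ` and node U5's output `MatchingUnder D Hβ` are EQUIVALENT (`T4MatchingDegenerate.hybridNE7Under_iff_matchingUnder`:
  ⇒ is node U5, ⇐ the DEGENERATE one-class expansion); `D.AvgMeasurable` HOLDS at every `Node00.IsRecordOfRecord₁₁C` record (module 1's
  `avgMeasurable_of_isRecordOfRecord₁₁C`).  Hence over `Rec₁₁ := fun F D w ↦ Node00.IsRecordOfRecord₁₁C F N D w`: the K5∕B5 cluster conclusion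
  `YMDAG.UVSplit.Spine Rec₁₁` (B5 at every ₁₁ record) ⟺ «`MatchingUnder D END` at every ₁₁ record» (`spine_rec₁₁_iff_matchingUnder`).  READING (why it is
  recorded, in n23-b's words): the hybrid packaging — bad classes, shells, budgets — is BOOKKEEPING for HOW NE7b ∕ NE7c ∕ NE7-core are to be proved along
  Bałaban's runs; AS A HYPOTHESIS SHAPE at the record, B5 carries exactly the content of N19's DECL target, no more and no less.  So the split K5 =
  N27x · N20 · N21 · N19′ is a PROOF STRUCTURE for N19's target, not a weakening of it, and a knit landing on `MatchingUnder D END` at ₁₁ (module 1)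
  lands on B5 at ₁₁ (`spine_rec₁₁_of_matchingUnder`); and conversely U4′'s budget half `hlt` of module 1 is NOT needed for the TARGET (two summable budgets
  are eventually `< 1`, the head is free): `matchingUnder_at_record₁₁_of_rateStubs_tail` = n27-a XIV `spine_of_rateStubs_coreEdge` at ₁₁ ∘ §2.
* §3 THE ROUTE ITEM IN N19's CURRENCY (`N = 2`).  `Summit.QuantumFields.YangMills.Theses.BalabanUVNodes.SpineGivenEndpointR11` (item stmt-QuantumFields-19676,
  Theses/BalabanUVNodes.lean :302) ⟺ «at every `Node00.IsRecordOfRecord₁₁C F 2 D w`, `T4ApexVariance.MatchingUnder D (EndpointExistence D.C.toB12)`»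
  (`spineGivenEndpointR11_iff_matchingUnder_at_record₁₁`) — the crux K3 READ as N19's DECL target string-wise along every Stage-11 record's Wilson
  schemes under (B) and END.  The K3 faces FROM THE STUB TEXTS (`spineGivenEndpointR11_of_rateStubs_coreEdge`, `…_of_readings`,
  `spineGivenEndpointR11_iff_spine_rec11C`) are the composite node N27's (seat n27-c, modules XX∕XXI, INBOX l.12018) and are NOT stated here; §3 gives
  only the currency equivalence and its two directions.
* §4 THE ∃δ-EDGE FROM THE SYNCHRONISED-LEDGER READING (FAN-OUT v1.1 §N19 s2's second named source `…N19LedgerLink` ∕ `…LedgerLinkSync` ∕ `…CentreSync`):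
  n27-a's `BalabanUVNodesN27AtRecordReadings.coreEdge_of_ledgerAtSyncReading` (the reading VERBATIM = n19-a's `s_N19_of_ledgerAtSyncReading` hypothesis:
  `LedgerAtSync` package + N16 `NE3Shape`∕`GaugeDominated` · N18 `NE5` · N22 `NE9 ∧ FadingMemory` · N17 via `InjectedRate` · (T) `LipBackground`∕`PolyLipGrowth`
  BY NAME ⇒ `∃ δ, Core ∧ Summable δ` by `N19LedgerLinkSync.core_summable_of_ledgerAtSync` p414645) composed with module 1's `matching_at_record₁₁_of_coreEdge`
  ∕ `stringwiseMatching_at_record₁₁_of_spineRates`: N19's DECL target at every ₁₁ record from the READING currency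
  (`matching_at_record₁₁_of_ledgerAtSyncReading`, `matchingUnder_at_record₁₁_of_ledgerAtSyncReading`).

HONEST FRAMING.  Bookkeeping equivalences and compositions of tree theorems BY NAME; 0 `def`, 0 `sorry`, standard axioms.  NE7 is NOT PRINTED and NOT
PROVED; every stub ∕ edge ∕ reading is a HYPOTHESIS, `SRec` ∕ `RRec` ∕ `Inputs` PARAMETERS (no spine- or rate-carrier predicate of record in the tree);
nothing of Bałaban's is asserted or instantiated; N19 NOT discharged; K3 NOT closed (§3 is an `↔` READING of the item, not a proof of either side);
Track A count unmoved (5∕27).  One finite four-torus at fixed ε, rung (B)+1 — NOT infinite volume, NOT OS on ℝ⁴, NOT a mass gap, NOT Clay.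
-/

set_option autoImplicit false

noncomputable section

namespace Summit.QuantumFields.YangMills.BalabanUVNodes.N19TargetAtRecord11

open Literature.MathematicalPhysics.QuantumFieldTheory.Balaban1983to89
open Literature.MathematicalPhysics.QuantumFieldTheory.Balaban1983to89.T4Continuum
open T4OutputRate T4RecentScale T4GoodClassBudget T4CauchySum T4TowerRateComposition T4TowerRateDischarge
open T4EtaRateMin (Readings NE3Shape)
open T4RateLiaison (GaugeDominated)
open T4ContinuumYM4Torus (ForSmallCouplings)
open T4ApexVariance (StringwiseMatching MatchingUnder matchingUnder_of_hybridNE7Under)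
open T4MatchingDegenerate (hybridNE7Under_of_matchingUnder)
open Summit.QuantumFields.BalabanUV.T4Continuum.Spine
open Summit.QuantumFields.YangMills.BalabanUVNodes.N19LedgerLinkSync (LedgerDataSync LedgerAtSync)
open Summit.QuantumFields.YangMills.Theorems.BalabanUVNodesN27SpineRecord (coreEdge_of_ledgerAtSyncReading spine_of_rateStubs_coreEdge)
open YMDAG.UVSplit (Datum RecordPred SpineCarriers SpineRecordPred InputsPred RateCarriers RateRecordPred RatesAt RateInputs Spine
  S_N27x S_N20 S_N21 SpineRates S_R00x S_N14 S_N15 S_N16 S_N17 S_N18 S_N22)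

/-! ## §1 The name: module 1's conclusion IS `T4ApexVariance.MatchingUnder D END` -/

section Name

variable {N : ℕ} [NeZero N]

/-- [bookkeeping] `MatchingUnder D Hβ` is `D.UnderHypotheses Hβ (g₀ ↦ StringwiseMatching (D.scheme g₀))` — definitional (`Iff.rfl`); recorded so that
module 1's conclusions are cited in the apex lineage's name. [folklore] -/
theorem matchingUnder_iff_underHypotheses {F : T4Family} (D : Datum F N) (Hβ : Prop) :
    MatchingUnder D Hβ ↔ D.UnderHypotheses Hβ fun g₀ => StringwiseMatching (D.scheme g₀) :=
  Iff.rfl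

/-- **N19's DECL TARGET UNDER THE PREFIX, BY NAME, K4 CONSUMED** [bookkeeping]: module 1's `stringwiseMatching_at_record₁₁_of_spineRates` in the name
`T4ApexVariance.MatchingUnder D END` — from `S_N27x Rec₁₁ SRec` · `S_N20` · `S_N21` · U4′'s budget half · N19's ∃δ-edge · K4's hook `SpineRates Rec₁₁ Inputs`,
at every ₁₁ record. [folklore] -/
theorem matchingUnder_at_record₁₁_of_spineRates (SRec : SpineRecordPred N) (Inputs : InputsPred N)
    (hx : S_N27x (fun F D w => Node00.IsRecordOfRecord₁₁C F N D w) SRec) (h20 : S_N20 SRec) (h21 : S_N21 SRec)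
    (hlt : ∀ (F : T4Family) (D : Datum F N) (g₀ : ℕ → ℝ) (os : List (ULoop F)) (S : SpineCarriers),
      SRec F D g₀ os S → ∀ K, S.W K + S.Wsh K < 1)
    (hedge : ∀ (F : T4Family) (D : Datum F N) (g₀ : ℕ → ℝ) (os : List (ULoop F)) (S : SpineCarriers),
      SRec F D g₀ os S → Inputs F D g₀ os → letI := S.dec
      ∃ δ : ℕ → ℝ, NE7.Core S.l₀ S.vol S.T S.Bad (fun K t τ => S.A K t τ - S.shA K t τ)
        (fun K t τ => S.B K t τ - S.shB K t τ) δ ∧ Summable δ)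
    (h4 : SpineRates (fun F D w => Node00.IsRecordOfRecord₁₁C F N D w) Inputs)
    {F : T4Family} {D : Datum F N} {w : DagBinding.WorldP} (hR : Node00.IsRecordOfRecord₁₁C F N D w) :
    MatchingUnder D (DagBinding.EndpointExistence D.C.toB12) :=
  stringwiseMatching_at_record₁₁_of_spineRates SRec Inputs hx h20 h21 hlt hedge h4 hR

/-- **N19's DECL TARGET UNDER THE PREFIX FROM THE STUB TEXTS OF MODULES 1 AND 2 AND N19's RATE EDGE, BY NAME** [bookkeeping]: module 1's top
`stringwiseMatching_at_record₁₁_of_rateStubs` in the name `MatchingUnder D END` — `S_R00x` · `S_N14` … `S_N22` at `RRec` (all six in-edges), `S_N27x` · `S_N20` ·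
`S_N21` · U4′'s budget half at `SRec`, the rate edge «`SRec ∧ RRec ∧ RatesAt ⇒ ∃ δ, Core ∧ Summable δ`», at every ₁₁ record. [folklore] -/
theorem matchingUnder_at_record₁₁_of_rateStubs (SRec : SpineRecordPred N) (RRec : RateRecordPred N)
    (hxR : S_R00x (fun F D w => Node00.IsRecordOfRecord₁₁C F N D w) RRec) (h14 : S_N14 RRec) (h15 : S_N15 RRec) (h16 : S_N16 RRec)
    (h17 : S_N17 RRec) (h18 : S_N18 RRec) (h22 : S_N22 RRec)
    (hx : S_N27x (fun F D w => Node00.IsRecordOfRecord₁₁C F N D w) SRec) (h20 : S_N20 SRec) (h21 : S_N21 SRec)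
    (hlt : ∀ (F : T4Family) (D : Datum F N) (g₀ : ℕ → ℝ) (os : List (ULoop F)) (S : SpineCarriers),
      SRec F D g₀ os S → ∀ K, S.W K + S.Wsh K < 1)
    (hedgeR : ∀ (F : T4Family) (D : Datum F N) (g₀ : ℕ → ℝ) (os : List (ULoop F)) (S : SpineCarriers) (R : RateCarriers N),
      SRec F D g₀ os S → RRec F D g₀ os R → RatesAt D R → letI := S.dec
      ∃ δ : ℕ → ℝ, NE7.Core S.l₀ S.vol S.T S.Bad (fun K t τ => S.A K t τ - S.shA K t τ)
        (fun K t τ => S.B K t τ - S.shB K t τ) δ ∧ Summable δ)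
    {F : T4Family} {D : Datum F N} {w : DagBinding.WorldP} (hR : Node00.IsRecordOfRecord₁₁C F N D w) :
    MatchingUnder D (DagBinding.EndpointExistence D.C.toB12) :=
  stringwiseMatching_at_record₁₁_of_rateStubs SRec RRec hxR h14 h15 h16 h17 h18 h22 hx h20 h21 hlt hedgeR hR

end Name

/-! ## §2 The reading at ₁₁: binder B5 at a Stage-11 record IS N19's DECL target along its Wilson schemes -/

section Reading

variable {N : ℕ} [NeZero N]

/-- **B5 ⇔ N19's TARGET AT ONE STAGE-11 RECORD** [bookkeeping]: at every `Node00.IsRecordOfRecord₁₁C F N D w` and for every β-binder `Hβ`,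
`T4ApexHybrid.HybridNE7Under D Hβ ↔ T4ApexVariance.MatchingUnder D Hβ` — `T4MatchingDegenerate.hybridNE7Under_iff_matchingUnder` with `D.AvgMeasurable` from the
record (`avgMeasurable_of_isRecordOfRecord₁₁C`). [folklore] -/
theorem hybridNE7Under_iff_matchingUnder_of_isRecordOfRecord₁₁C {F : T4Family} {D : Datum F N} {w : DagBinding.WorldP}
    (hR : Node00.IsRecordOfRecord₁₁C F N D w) (Hβ : Prop) :
    T4ApexHybrid.HybridNE7Under D Hβ ↔ MatchingUnder D Hβ :=
  T4MatchingDegenerate.hybridNE7Under_iff_matchingUnder D (avgMeasurable_of_isRecordOfRecord₁₁C hR) Hβ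

/-- **THE K5∕B5 CLUSTER CONCLUSION AT ₁₁ ⇔ N19's DECL TARGET AT EVERY ₁₁ RECORD** [bookkeeping]: over the record predicate
`fun F D w ↦ Node00.IsRecordOfRecord₁₁C F N D w`, `YMDAG.UVSplit.Spine` (B5 = `HybridNE7Under D END` at every record pair) holds IFF at every ₁₁ record
`MatchingUnder D END` holds — the hybrid packaging carries, as a hypothesis shape at the record, exactly the content of matching modulo constants with a
summable remainder, string by string. [folklore] -/
theorem spine_rec₁₁_iff_matchingUnder :
    Spine (N := N) (fun F D w => Node00.IsRecordOfRecord₁₁C F N D w) ↔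
      ∀ (F : T4Family) (D : Datum F N) (w : DagBinding.WorldP), Node00.IsRecordOfRecord₁₁C F N D w →
        MatchingUnder D (DagBinding.EndpointExistence D.C.toB12) :=
  ⟨fun h F D w hR => (hybridNE7Under_iff_matchingUnder_of_isRecordOfRecord₁₁C hR _).mp (h F D w hR),
    fun h F D w hR => (hybridNE7Under_iff_matchingUnder_of_isRecordOfRecord₁₁C hR _).mpr (h F D w hR)⟩

/-- **… IN PARTICULAR A KNIT LANDING ON N19's TARGET AT ₁₁ LANDS ON B5 AT ₁₁** [bookkeeping] (the direction used downstream: `MatchingUnder D END` at every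
₁₁ record ⇒ `Spine Rec₁₁`, by the degenerate expansion). [folklore] -/
theorem spine_rec₁₁_of_matchingUnder
    (h : ∀ (F : T4Family) (D : Datum F N) (w : DagBinding.WorldP), Node00.IsRecordOfRecord₁₁C F N D w →
      MatchingUnder D (DagBinding.EndpointExistence D.C.toB12)) :
    Spine (N := N) fun F D w => Node00.IsRecordOfRecord₁₁C F N D w :=
  spine_rec₁₁_iff_matchingUnder.mpr h

/-- **… AND CONVERSELY B5 AT ₁₁ GIVES N19's TARGET AT ₁₁** [bookkeeping] (node U5 by name at the record). [folklore] -/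
theorem matchingUnder_of_spine_rec₁₁ (h : Spine (N := N) fun F D w => Node00.IsRecordOfRecord₁₁C F N D w)
    {F : T4Family} {D : Datum F N} {w : DagBinding.WorldP} (hR : Node00.IsRecordOfRecord₁₁C F N D w) :
    MatchingUnder D (DagBinding.EndpointExistence D.C.toB12) :=
  spine_rec₁₁_iff_matchingUnder.mp h F D w hR

/-- **THE BUDGET HALF IS A TAIL PROPERTY — N19's TARGET AT ₁₁ FROM THE STUB TEXTS WITHOUT `hlt`** [bookkeeping]: module 1's top theorem asks U4′'s budget
half `∀ K, S.W K + S.Wsh K < 1` because it fills `HybridNE7.lt_one` LITERALLY at the carriers; for the TARGET it is not needed — two summable budgets are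
eventually `< 1` and the head is free (n27-a XII `spineDatum_of_tail`).  Kernel: n27-a XIV `spine_of_rateStubs_coreEdge` at `Rec₁₁` (B5 from `S_R00x` ·
`S_N14` … `S_N22` · `S_N27x` · `S_N20` · `S_N21` · the rate edge, NO `hlt`, NO `S.δ`) then §2's `matchingUnder_of_spine_rec₁₁`. [folklore] -/
theorem matchingUnder_at_record₁₁_of_rateStubs_tail (SRec : SpineRecordPred N) (RRec : RateRecordPred N)
    (hxR : S_R00x (fun F D w => Node00.IsRecordOfRecord₁₁C F N D w) RRec) (h14 : S_N14 RRec) (h15 : S_N15 RRec) (h16 : S_N16 RRec)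
    (h17 : S_N17 RRec) (h18 : S_N18 RRec) (h22 : S_N22 RRec)
    (hx : S_N27x (fun F D w => Node00.IsRecordOfRecord₁₁C F N D w) SRec) (h20 : S_N20 SRec) (h21 : S_N21 SRec)
    (hedgeR : ∀ (F : T4Family) (D : Datum F N) (g₀ : ℕ → ℝ) (os : List (ULoop F)) (S : SpineCarriers) (R : RateCarriers N),
      SRec F D g₀ os S → RRec F D g₀ os R → RatesAt D R → letI := S.dec
      ∃ δ : ℕ → ℝ, NE7.Core S.l₀ S.vol S.T S.Bad (fun K t τ => S.A K t τ - S.shA K t τ)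
        (fun K t τ => S.B K t τ - S.shB K t τ) δ ∧ Summable δ)
    {F : T4Family} {D : Datum F N} {w : DagBinding.WorldP} (hR : Node00.IsRecordOfRecord₁₁C F N D w) :
    MatchingUnder D (DagBinding.EndpointExistence D.C.toB12) :=
  matchingUnder_of_spine_rec₁₁
    (spine_of_rateStubs_coreEdge (fun F D w => Node00.IsRecordOfRecord₁₁C F N D w) SRec RRec hxR h14 h15 h16 h17 h18 h22 hx h20 h21
      hedgeR) hR

end Reading

/-! ## §3 The route item K3 `SpineGivenEndpointR11` READ IN N19's CURRENCY (`N = 2`) -/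

section Route

open Summit.QuantumFields.YangMills.Theses.BalabanUVNodes (SpineGivenEndpointR11)

/-- **THE CRUX K3 IS N19's DECL TARGET ALONG EVERY STAGE-11 RECORD's WILSON SCHEMES** [bookkeeping]: `SpineGivenEndpointR11` (item stmt-QuantumFields-19676:
at every `Node00.IsRecordOfRecord₁₁C F 2 D w`, (B) → END → `HybridNE7Under D END`) ⟺ «at every such record, `T4ApexVariance.MatchingUnder D END`» (whose own
prefix is (B) → END → for all small couplings).  (⇒) node U5 by name (`matchingUnder_of_hybridNE7Under`, `AvgMeasurable` from the record); (⇐) the degenerate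
expansion (`hybridNE7Under_of_matchingUnder`).  An `↔` READING of the item; neither side is proved here. [folklore] -/
theorem spineGivenEndpointR11_iff_matchingUnder_at_record₁₁ :
    SpineGivenEndpointR11 ↔
      ∀ (F : T4Family) (D : FiniteEpsData F (Matrix.specialUnitaryGroup (Fin 2) ℂ)) (w : DagBinding.WorldP),
        Node00.IsRecordOfRecord₁₁C F 2 D w → MatchingUnder D (DagBinding.EndpointExistence D.C.toB12) := by
  constructor
  · intro h F D w hR hB hE
    exact matchingUnder_of_hybridNE7Under D (avgMeasurable_of_isRecordOfRecord₁₁C hR) (h F D w hR hB hE) hB hE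
  · intro h F D w hR hB hE
    exact hybridNE7Under_of_matchingUnder D (avgMeasurable_of_isRecordOfRecord₁₁C hR) (h F D w hR)

/-- **THE N19-CURRENCY FACE OF K3** [bookkeeping]: N19's DECL target `MatchingUnder D END` at every Stage-11 record of `SU(2)` data gives `SpineGivenEndpointR11`.
Its hypothesis is what module 1's `matchingUnder_at_record₁₁_of_rateStubs` ∕ §4's `matchingUnder_at_record₁₁_of_ledgerAtSyncReading` conclude at `N = 2`
GIVEN their stubs, edges and readings — all of which are hypotheses with no producer at the record today; the composite K3-from-stubs faces are N27's
(n27-c XXI).  NOT a proof of K3. [folklore] -/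
theorem spineGivenEndpointR11_of_matchingUnder_at_record₁₁
    (h : ∀ (F : T4Family) (D : FiniteEpsData F (Matrix.specialUnitaryGroup (Fin 2) ℂ)) (w : DagBinding.WorldP),
      Node00.IsRecordOfRecord₁₁C F 2 D w → MatchingUnder D (DagBinding.EndpointExistence D.C.toB12)) :
    SpineGivenEndpointR11 :=
  spineGivenEndpointR11_iff_matchingUnder_at_record₁₁.mpr h

/-- **… and K3 hands N19's target back at every ₁₁ record** [bookkeeping]. [folklore] -/
theorem matchingUnder_at_record₁₁_of_spineGivenEndpointR11 (h : SpineGivenEndpointR11) {F : T4Family}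
    {D : FiniteEpsData F (Matrix.specialUnitaryGroup (Fin 2) ℂ)} {w : DagBinding.WorldP} (hR : Node00.IsRecordOfRecord₁₁C F 2 D w) :
    MatchingUnder D (DagBinding.EndpointExistence D.C.toB12) :=
  spineGivenEndpointR11_iff_matchingUnder_at_record₁₁.mp h F D w hR

end Route

/-! ## §4 The ∃δ-edge from the SYNCHRONISED-LEDGER READING (n19-a ∕ n27-a currency) ⇒ N19's target at every ₁₁ record -/

section LedgerReading

variable {N : ℕ} [NeZero N]

/-- **N19's DECL TARGET AT EVERY STAGE-11 RECORD FROM THE SYNCHRONISED-LEDGER READING, GUARDED BY K4's CONCLUSION** [bookkeeping].  Hypotheses: `S_N27x Rec₁₁ SRec`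
· `S_N20` · `S_N21` · U4′'s budget half, and the READING of n19-a's `N19AtSpineCarriers.s_N19_of_ledgerAtSyncReading` VERBATIM (with every bundle `S` and K4's
conclusion, `SRec ∧ Inputs` hand rate carriers `C`, a reading family `R`, ledger data `L` with `LedgerAtSync L S.l₀ S.vol S.T S.Bad (A − shA) (B − shB) R EA EB κ g uA uB ω θc θ₅ θ₃`
and the in-edges BY NAME — N16 `NE3Shape` + `GaugeDominated`, N18 `NE5`, N22 `NE9 ∧ FadingMemory`, N17 via node U2's `InjectedRate`, (T) `LipBackground` + `PolyLipGrowth`,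
window memberships); the ∃δ-edge is n27-a's `coreEdge_of_ledgerAtSyncReading` (`N19LedgerLinkSync.core_summable_of_ledgerAtSync` BY NAME), then module 1's
`matching_at_record₁₁_of_coreEdge`. [folklore] -/
theorem matching_at_record₁₁_of_ledgerAtSyncReading (SRec : SpineRecordPred N) (Inputs : InputsPred N)
    (hx : S_N27x (fun F D w => Node00.IsRecordOfRecord₁₁C F N D w) SRec) (h20 : S_N20 SRec) (h21 : S_N21 SRec)
    (hlt : ∀ (F : T4Family) (D : Datum F N) (g₀ : ℕ → ℝ) (os : List (ULoop F)) (S : SpineCarriers),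
      SRec F D g₀ os S → ∀ K, S.W K + S.Wsh K < 1)
    (hread : ∀ (F : T4Family) (D : Datum F N) (g₀ : ℕ → ℝ) (os : List (ULoop F)) (S : SpineCarriers),
      SRec F D g₀ os S → Inputs F D g₀ os → letI := S.dec
      ∃ (C : Carriers) (_ : DecidableEq C.Dom) (F' : Type) (ι' X' : Type) (_ : MeasurableSpace ι')
        (L : LedgerDataSync C F' ι' S.ι) (R : Readings ι' X') (W : Set (ℕ → ℝ)) (EA : Functional C C.BgA)
        (EB : Functional C C.BgB) (κ θ₅ C₅ C₉ ω θc Cd γ C₃ θ₃ Pg : ℝ) (q : ℕ) (Λm : ℕ → ℕ → ℝ)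
        (CU : (ℕ → ℝ) → ℕ → ℝ) (g : ℕ → ℕ → ℝ) (uA : ℕ → ι' → C.BgA) (uB : ℕ → ι' → C.BgB),
        LedgerAtSync L S.l₀ S.vol S.T S.Bad (fun K t τ => S.A K t τ - S.shA K t τ) (fun K t τ => S.B K t τ - S.shB K t τ)
          R EA EB κ g uA uB ω θc θ₅ θ₃ ∧
        NE3Shape R C₃ θ₃ ∧ 0 ≤ C₃ ∧ GaugeDominated R uA uB ∧
        NE5 EA EB W κ θ₅ C₅ ∧ 0 ≤ θ₅ ∧ 0 ≤ C₅ ∧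
        (NE9 EA W κ Λm ∧ T4OutputRate.FadingMemory C₉ ω Λm) ∧ 0 ≤ ω ∧
        InjectedRate Cd 0 θc (fun K j => T4CouplingMatching.disc (g K) (g (K + 1)) j) ∧ 0 ≤ Cd ∧ 0 ≤ θc ∧
        (∀ K i, i ≤ K → 0 < g K i ∧ g K i ≤ γ) ∧
        LipBackground EA W κ CU ∧ PolyLipGrowth CU g Pg q ∧ 0 ≤ Pg ∧
        (∀ K, g K ∈ W) ∧ (∀ K, (fun i => g (K + 1) (i + 1)) ∈ W))
    {F : T4Family} {D : Datum F N} {w : DagBinding.WorldP} (hR : Node00.IsRecordOfRecord₁₁C F N D w)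
    (hB : B16.EndStatementBPrinted D.C) (hE : DagBinding.EndpointExistence D.C.toB12) :
    ForSmallCouplings D fun g₀ => ∀ os : List (ULoop F), Inputs F D g₀ os →
      ∃ (l₀ vol : ℝ) (δ' : ℕ → ℝ), 0 < l₀ ∧ Summable δ' ∧
        MatchingModConstants vol l₀ δ' (T4GenFunBounds.schemeZ (D.scheme g₀) os) :=
  matching_at_record₁₁_of_coreEdge SRec Inputs hx h20 h21 hlt (coreEdge_of_ledgerAtSyncReading SRec Inputs hread) hR hB hE

/-- **… K4 CONSUMED, IN THE NAME `MatchingUnder D END`** [bookkeeping]: with K4's hook `SpineRates Rec₁₁ Inputs`, the synchronised-ledger reading gives N19's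
DECL target under the prefix at every ₁₁ record (module 1's `stringwiseMatching_at_record₁₁_of_spineRates` on n27-a's `coreEdge_of_ledgerAtSyncReading`). [folklore] -/
theorem matchingUnder_at_record₁₁_of_ledgerAtSyncReading (SRec : SpineRecordPred N) (Inputs : InputsPred N)
    (hx : S_N27x (fun F D w => Node00.IsRecordOfRecord₁₁C F N D w) SRec) (h20 : S_N20 SRec) (h21 : S_N21 SRec)
    (hlt : ∀ (F : T4Family) (D : Datum F N) (g₀ : ℕ → ℝ) (os : List (ULoop F)) (S : SpineCarriers),
      SRec F D g₀ os S → ∀ K, S.W K + S.Wsh K < 1)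
    (hread : ∀ (F : T4Family) (D : Datum F N) (g₀ : ℕ → ℝ) (os : List (ULoop F)) (S : SpineCarriers),
      SRec F D g₀ os S → Inputs F D g₀ os → letI := S.dec
      ∃ (C : Carriers) (_ : DecidableEq C.Dom) (F' : Type) (ι' X' : Type) (_ : MeasurableSpace ι')
        (L : LedgerDataSync C F' ι' S.ι) (R : Readings ι' X') (W : Set (ℕ → ℝ)) (EA : Functional C C.BgA)
        (EB : Functional C C.BgB) (κ θ₅ C₅ C₉ ω θc Cd γ C₃ θ₃ Pg : ℝ) (q : ℕ) (Λm : ℕ → ℕ → ℝ)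
        (CU : (ℕ → ℝ) → ℕ → ℝ) (g : ℕ → ℕ → ℝ) (uA : ℕ → ι' → C.BgA) (uB : ℕ → ι' → C.BgB),
        LedgerAtSync L S.l₀ S.vol S.T S.Bad (fun K t τ => S.A K t τ - S.shA K t τ) (fun K t τ => S.B K t τ - S.shB K t τ)
          R EA EB κ g uA uB ω θc θ₅ θ₃ ∧
        NE3Shape R C₃ θ₃ ∧ 0 ≤ C₃ ∧ GaugeDominated R uA uB ∧
        NE5 EA EB W κ θ₅ C₅ ∧ 0 ≤ θ₅ ∧ 0 ≤ C₅ ∧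
        (NE9 EA W κ Λm ∧ T4OutputRate.FadingMemory C₉ ω Λm) ∧ 0 ≤ ω ∧
        InjectedRate Cd 0 θc (fun K j => T4CouplingMatching.disc (g K) (g (K + 1)) j) ∧ 0 ≤ Cd ∧ 0 ≤ θc ∧
        (∀ K i, i ≤ K → 0 < g K i ∧ g K i ≤ γ) ∧
        LipBackground EA W κ CU ∧ PolyLipGrowth CU g Pg q ∧ 0 ≤ Pg ∧
        (∀ K, g K ∈ W) ∧ (∀ K, (fun i => g (K + 1) (i + 1)) ∈ W))
    (h4 : SpineRates (fun F D w => Node00.IsRecordOfRecord₁₁C F N D w) Inputs)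
    {F : T4Family} {D : Datum F N} {w : DagBinding.WorldP} (hR : Node00.IsRecordOfRecord₁₁C F N D w) :
    MatchingUnder D (DagBinding.EndpointExistence D.C.toB12) :=
  stringwiseMatching_at_record₁₁_of_spineRates SRec Inputs hx h20 h21 hlt (coreEdge_of_ledgerAtSyncReading SRec Inputs hread) h4 hR

end LedgerReading

end Summit.QuantumFields.YangMills.BalabanUVNodes.N19TargetAtRecord11

end
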